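import Summits.FinalStateConjecture.FinalStateConjecture.Theorems.ClusterCompletenessAdiabaticMultiKerrILEDHardyCurrent

/-!
# Crux `AdiabaticMultiKerrILED` (line `Sketch`) — the designed Morawetz bulk dominates the
# energy density away from the photon sphere and the horizon

Helper file for the crux `stmt-FinalStateConjecture-14310`
(`Summit.FinalStateConjecture.FinalStateConjecture.Theses.ClusterCompleteness.AdiabaticMultiKerrILED`),
line `Sketch`, stub `morawetzBulk_dominates` (lead c7, wave 8, final assembly of the
non-degenerate integrated local energy decay estimate).

Rest frame, zero spin: `r = Kerr.radius 0 x = ‖x⃗‖`, `Kerr.scalarH M 0 x = M/r`, tails-cut profile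
`μ = χ(2 − r/8M) · 2M/r ∈ [0, 2M/r]` (`χ = Real.smoothTransition`), tortoise derivative
`∂_{r*}Φ = (1 − μ)(x⃗·∇Φ)/r + μ ∂₀Φ`, angular gradient `|∇̸Φ|² = ∑ᵢ (∂ᵢΦ)² − (x⃗·∇Φ)²/r² ≥ 0`
(Cauchy–Schwarz). The designed Morawetz bulk of the line is
`𝔅 = c_T (∂₀Φ)² + c_R (∂_{r*}Φ)² + c_A |∇̸Φ|² + c_0 Φ²`,
`c_T = (r − 2M) M³ (r − 3M)²/(2r⁷)`, `c_R = 3M/(20 r²)`, `c_A = (r − 3M)²/(8 r³)`,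
`c_0 = 𝟙_{r ≥ 7M} M (r − 7M)/(4 r⁵)`; all four summands are nonnegative on `{r > 2M}`.
`morawetzBulk_dominates`: with one constant `K = K(M, η, R_z) ≥ 0`,
(1) `∑_μ (∂_μΦ)² ≤ K 𝔅` on `2M + η ≤ r ≤ R_z` off the photon-sphere layer `(5M/2, 7M/2)`
(there `c_T ≥ η M⁵/(8R⁷)`, `c_R ≥ 3M/(20R²)`, `c_A ≥ M²/(32R³)`, `R = max R_z 1`, and
`(x⃗·∇Φ)²/r² ≤ 2(R/η)² ((∂_{r*}Φ)² + (∂₀Φ)²)` since `1 − μ ≥ (r − 2M)/r ≥ η/R`);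
(2) `(∂_{r*}Φ)² ≤ K 𝔅` on `2M < r ≤ R_z`; (3) `(r − 3M)² (∂₀Φ)² ≤ K M³ 𝔅` on `[9M/4, 15M/4]`;
(4) `Φ² ≤ K M³ 𝔅` on `[15M/2, 9M]`. Elementary real algebra, done on named atoms in
`morawetzBulk_dominates_abstract` (Dafermos–Rodnianski arXiv:0811.0354, §4.1). [folklore]
-/

noncomputable section

-- the doubled `FinalStateConjecture.FinalStateConjecture` path component trips dupNamespace
set_option linter.dupNamespace false

open scoped BigOperators
open Literature.Geometry.Lorentzian

namespace Summit.FinalStateConjecture.FinalStateConjecture.Theorems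

/-! ### Elementary real inequalities -/

/-- `a X ≤ K (c X)` when `0 ≤ X`, `0 < x₀ ≤ c`, `0 ≤ a` and `a/x₀ ≤ K`. [folklore] -/
theorem morawetzBulk_mul_le_mul_mul {X x₀ c a K : ℝ} (hX : 0 ≤ X) (hx₀ : 0 < x₀) (hc : x₀ ≤ c)
    (ha : 0 ≤ a) (hK : a / x₀ ≤ K) : a * X ≤ K * (c * X) :=
  calc a * X = a / x₀ * (x₀ * X) := by rw [div_mul_eq_mul_div, eq_div_iff hx₀.ne']; ring
    _ ≤ a / x₀ * (c * X) :=
        mul_le_mul_of_nonneg_left (mul_le_mul_of_nonneg_right hc hX) (div_nonneg ha hx₀.le)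
    _ ≤ K * (c * X) := mul_le_mul_of_nonneg_right hK (mul_nonneg (hx₀.le.trans hc) hX)

/-- **Abstract form of the domination estimate.** For reals `T = ∂₀Φ`, `S = x⃗·∇Φ` with
`S² ≤ r² A` (`A = ∑ᵢ (∂ᵢΦ)²`, Cauchy–Schwarz), a profile `0 ≤ m ≤ 2M/r`, `φ = Φ(x)` and the bulk
`B = c_T T² + c_R ((1 − m) S/r + m T)² + c_A (A − (S/r)²) + c_0 φ²`, the four domination
inequalities hold with one constant `K = K(M, η, R_z) ≥ 0`.
Dafermos–Rodnianski arXiv:0811.0354, §4.1. [folklore] -/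
theorem morawetzBulk_dominates_abstract {M η : ℝ} (Rz : ℝ) (hM : 0 < M) (hη : 0 < η) :
    ∃ K : ℝ, 0 ≤ K ∧ ∀ (r T S A m φ B : ℝ), S ^ 2 ≤ r ^ 2 * A → 0 ≤ m → m ≤ 2 * M / r →
      B = (r - 2 * M) * M ^ 3 * (r - 3 * M) ^ 2 / (2 * r ^ 7) * T ^ 2 +
          3 * M / (20 * r ^ 2) * ((1 - m) * S / r + m * T) ^ 2 +
          (r - 3 * M) ^ 2 / (8 * r ^ 3) * (A - (S / r) ^ 2) +
          (if 7 * M ≤ r then M * (r - 7 * M) / (4 * r ^ 5) else 0) * φ ^ 2 →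
      (2 * M + η ≤ r → r ≤ Rz → (r ≤ 5 * M / 2 ∨ 7 * M / 2 ≤ r) → T ^ 2 + A ≤ K * B) ∧
      (2 * M < r → r ≤ Rz → ((1 - m) * S / r + m * T) ^ 2 ≤ K * B) ∧
      (9 * M / 4 ≤ r → r ≤ 15 * M / 4 → (r - 3 * M) ^ 2 * T ^ 2 ≤ K * M ^ 3 * B) ∧
      (15 * M / 2 ≤ r → r ≤ 9 * M → φ ^ 2 ≤ K * M ^ 3 * B) := by
  -- the constants
  obtain ⟨R, hRz, hR1⟩ : ∃ R : ℝ, Rz ≤ R ∧ 1 ≤ R := ⟨max Rz 1, le_max_left _ _, le_max_right _ _⟩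
  have hR0 : 0 < R := one_pos.trans_le hR1
  obtain ⟨ℓ, hℓ⟩ : ∃ l : ℝ, l = 2 * R ^ 2 / η ^ 2 := ⟨_, rfl⟩
  obtain ⟨t₀, ht₀⟩ : ∃ t : ℝ, t = η * M ^ 5 / (8 * R ^ 7) := ⟨_, rfl⟩
  obtain ⟨ρ₀, hρ₀⟩ : ∃ ρ : ℝ, ρ = 3 * M / (20 * R ^ 2) := ⟨_, rfl⟩
  obtain ⟨α₀, hα₀⟩ : ∃ α : ℝ, α = M ^ 2 / (32 * R ^ 3) := ⟨_, rfl⟩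
  obtain ⟨K₃, hK₃⟩ : ∃ k : ℝ, k = 15 ^ 7 := ⟨_, rfl⟩
  obtain ⟨K₄, hK₄⟩ : ∃ k : ℝ, k = 8 * 9 ^ 5 := ⟨_, rfl⟩
  have hℓ0 : 0 ≤ ℓ := by rw [hℓ]; positivity
  have ht₀0 : 0 < t₀ := by rw [ht₀]; positivity
  have hρ₀0 : 0 < ρ₀ := by rw [hρ₀]; positivity
  have hα₀0 : 0 < α₀ := by rw [hα₀]; positivity
  have hKa : 0 ≤ (1 + ℓ) / t₀ := by positivity
  have hKb : 0 ≤ 1 / α₀ := by positivity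
  have hKc : 0 ≤ ℓ / ρ₀ := by positivity
  have hKd : 0 ≤ 1 / ρ₀ := by positivity
  have hKe : 0 ≤ K₃ := by rw [hK₃]; positivity
  have hKf : 0 ≤ K₄ := by rw [hK₄]; positivity
  obtain ⟨K, hK⟩ : ∃ k : ℝ, k = (1 + ℓ) / t₀ + 1 / α₀ + ℓ / ρ₀ + 1 / ρ₀ + K₃ + K₄ := ⟨_, rfl⟩
  have hK0 : 0 ≤ K := by rw [hK]; linarith
  have hK1 : (1 + ℓ) / t₀ ≤ K := by rw [hK]; linarith
  have hK2 : 1 / α₀ ≤ K := by rw [hK]; linarith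
  have hK3 : ℓ / ρ₀ ≤ K := by rw [hK]; linarith
  have hK4 : 1 / ρ₀ ≤ K := by rw [hK]; linarith
  have hK5 : K₃ ≤ K := by rw [hK]; linarith
  have hK6 : K₄ ≤ K := by rw [hK]; linarith
  refine ⟨K, hK0, ?_⟩
  intro r T S A m φ B hCS hm0 hm1 hB
  rw [mul_div_assoc (1 - m) S r] at hB ⊢
  -- name the coefficients and the normalised radial derivative `u = S/r`
  obtain ⟨cT, hcT⟩ : ∃ c : ℝ, c = (r - 2 * M) * M ^ 3 * (r - 3 * M) ^ 2 / (2 * r ^ 7) :=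
    ⟨_, rfl⟩
  obtain ⟨cR, hcR⟩ : ∃ c : ℝ, c = 3 * M / (20 * r ^ 2) := ⟨_, rfl⟩
  obtain ⟨cA, hcA⟩ : ∃ c : ℝ, c = (r - 3 * M) ^ 2 / (8 * r ^ 3) := ⟨_, rfl⟩
  obtain ⟨c₀, hc₀⟩ : ∃ c : ℝ, c = if 7 * M ≤ r then M * (r - 7 * M) / (4 * r ^ 5) else 0 :=
    ⟨_, rfl⟩
  obtain ⟨u, hu⟩ : ∃ v : ℝ, v = S / r := ⟨_, rfl⟩
  rw [← hcT, ← hcR, ← hcA, ← hc₀, ← hu] at hB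
  rw [← hu]
  -- nonnegativity of the four summands of the bulk on `{r > 2M}`
  have key : 2 * M < r → 0 < r ∧ m ≤ 1 ∧ 0 ≤ cT * T ^ 2 ∧ 0 ≤ cR * ((1 - m) * u + m * T) ^ 2 ∧
      0 ≤ A - u ^ 2 ∧ 0 ≤ cA * (A - u ^ 2) ∧ 0 ≤ c₀ * φ ^ 2 := by
    intro hx
    have hr : 0 < r := lt_trans (by positivity) hx
    have hm : m ≤ 1 := hm1.trans ((div_le_one₀ hr).2 hx.le)
    have hA : 0 ≤ A - u ^ 2 := by
      rw [sub_nonneg, hu, div_pow, div_le_iff₀ (pow_pos hr 2)]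
      linarith
    have h0 : 0 ≤ c₀ := by
      rw [hc₀]
      split_ifs with h7
      · exact div_nonneg (mul_nonneg hM.le (sub_nonneg.2 h7)) (by positivity)
      · exact le_rfl
    have hT : 0 ≤ cT := by
      rw [hcT]
      exact div_nonneg (mul_nonneg (mul_nonneg (sub_nonneg.2 hx.le) (by positivity))
        (sq_nonneg _)) (by positivity)
    have hRc : 0 ≤ cR := by rw [hcR]; positivity
    have hAc : 0 ≤ cA := by rw [hcA]; positivity
    exact ⟨hr, hm, mul_nonneg hT (sq_nonneg _), mul_nonneg hRc (sq_nonneg _), hA,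
      mul_nonneg hAc hA, mul_nonneg h0 (sq_nonneg _)⟩
  -- `c_R ≥ ρ₀` on `0 < r ≤ R_z`
  have hcRlow : 0 < r → r ≤ Rz → ρ₀ ≤ cR := fun hr h2 ↦ by
    rw [hρ₀, hcR]
    have hr2 : r ^ 2 ≤ R ^ 2 := pow_le_pow_left₀ hr.le (h2.trans hRz) 2
    exact div_le_div_of_nonneg_left (by positivity) (by positivity) (by linarith)
  refine ⟨fun h1 h2 h3 ↦ ?_, fun h1 h2 ↦ ?_, fun h1 h2 ↦ ?_, fun h1 h2 ↦ ?_⟩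
  · -- (1) away from the photon sphere and the horizon
    obtain ⟨hr, hm, -, -, hang, -, hφ0⟩ := key (by linarith)
    have hrR : r ≤ R := h2.trans hRz
    have h3M : M ^ 2 / 4 ≤ (r - 3 * M) ^ 2 := by
      rcases h3 with h3 | h3
      · linarith only [mul_nonneg (sub_nonneg.2 h3)
          (by linarith only [h3, hM] : (0 : ℝ) ≤ 7 * M / 2 - r)]
      · linarith only [mul_nonneg (sub_nonneg.2 h3)
          (by linarith only [h3, hM] : (0 : ℝ) ≤ r - 5 * M / 2)]
    have hr7 : r ^ 7 ≤ R ^ 7 := pow_le_pow_left₀ hr.le hrR 7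
    have hr3 : r ^ 3 ≤ R ^ 3 := pow_le_pow_left₀ hr.le hrR 3
    -- lower bounds for the three derivative coefficients
    have hTlow : t₀ ≤ cT := by
      rw [ht₀, hcT, div_le_div_iff₀ (by positivity) (by positivity)]
      have hP0 : 0 ≤ (r - 2 * M) * (r - 3 * M) ^ 2 := mul_nonneg (by linarith) (sq_nonneg _)
      have ha : η * (M ^ 2 / 4) ≤ (r - 2 * M) * (r - 3 * M) ^ 2 :=
        mul_le_mul (by linarith) h3M (by positivity) (by linarith)
      have hb := mul_le_mul ha hr7 (by positivity) hP0
      calc η * M ^ 5 * (2 * r ^ 7) = 8 * M ^ 3 * (η * (M ^ 2 / 4) * r ^ 7) := by ring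
        _ ≤ 8 * M ^ 3 * ((r - 2 * M) * (r - 3 * M) ^ 2 * R ^ 7) :=
            mul_le_mul_of_nonneg_left hb (by positivity)
        _ = (r - 2 * M) * M ^ 3 * (r - 3 * M) ^ 2 * (8 * R ^ 7) := by ring
    have hRlow : ρ₀ ≤ cR := hcRlow hr h2
    have hAlow : α₀ ≤ cA := by
      rw [hα₀, hcA, div_le_div_iff₀ (by positivity) (by positivity)]
      have hb := mul_le_mul h3M hr3 (by positivity) (sq_nonneg _)
      calc M ^ 2 * (8 * r ^ 3) = 32 * (M ^ 2 / 4 * r ^ 3) := by ring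
        _ ≤ 32 * ((r - 3 * M) ^ 2 * R ^ 3) := by linarith
        _ = (r - 3 * M) ^ 2 * (32 * R ^ 3) := by ring
    -- the radial derivative through the tortoise one: `u² ≤ ℓ ((∂_{r*}Φ)² + T²)`
    have hw : η / R ≤ 1 - m := by
      have hmr : m * r ≤ 2 * M := (le_div_iff₀ hr).1 hm1
      rw [div_le_iff₀ hR0]
      linarith only [mul_nonneg (sub_nonneg.2 hm) (sub_nonneg.2 hrR), hmr, h1]
    have hul : u ^ 2 ≤ ℓ * (((1 - m) * u + m * T) ^ 2 + T ^ 2) := by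
      have hm2 : m ^ 2 ≤ 1 := pow_le_one₀ hm0 hm
      have h1' : (η / R) ^ 2 * u ^ 2 ≤ (1 - m) ^ 2 * u ^ 2 :=
        mul_le_mul_of_nonneg_right (pow_le_pow_left₀ (div_pos hη hR0).le hw 2) (sq_nonneg u)
      have h2' : (1 - m) ^ 2 * u ^ 2 ≤ 2 * (((1 - m) * u + m * T) ^ 2 + T ^ 2) := by
        linarith only [sq_nonneg ((1 - m) * u + 2 * m * T),
          mul_nonneg (sq_nonneg T) (sub_nonneg.2 hm2)]
      have h3' := h1'.trans h2'
      rw [div_pow, div_mul_eq_mul_div, div_le_iff₀ (pow_pos hR0 2)] at h3'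
      rw [hℓ, div_mul_eq_mul_div, le_div_iff₀ (pow_pos hη 2)]
      linarith
    -- assemble
    have e1 : (1 + ℓ) * T ^ 2 ≤ K * (cT * T ^ 2) :=
      morawetzBulk_mul_le_mul_mul (sq_nonneg T) ht₀0 hTlow (by positivity) hK1
    have e2 : 1 * (A - u ^ 2) ≤ K * (cA * (A - u ^ 2)) :=
      morawetzBulk_mul_le_mul_mul hang hα₀0 hAlow zero_le_one hK2
    have e3 : ℓ * ((1 - m) * u + m * T) ^ 2 ≤ K * (cR * ((1 - m) * u + m * T) ^ 2) :=
      morawetzBulk_mul_le_mul_mul (sq_nonneg _) hρ₀0 hRlow hℓ0 hK3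
    have hrest : cT * T ^ 2 + cR * ((1 - m) * u + m * T) ^ 2 + cA * (A - u ^ 2) ≤ B := by
      rw [hB]; linarith
    calc T ^ 2 + A = (1 + ℓ) * T ^ 2 + 1 * (A - u ^ 2) + (u ^ 2 - ℓ * T ^ 2) := by ring
      _ ≤ (1 + ℓ) * T ^ 2 + 1 * (A - u ^ 2) + ℓ * ((1 - m) * u + m * T) ^ 2 := by linarith
      _ ≤ K * (cT * T ^ 2) + K * (cA * (A - u ^ 2)) + K * (cR * ((1 - m) * u + m * T) ^ 2) :=
          add_le_add_three e1 e2 e3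
      _ = K * (cT * T ^ 2 + cR * ((1 - m) * u + m * T) ^ 2 + cA * (A - u ^ 2)) := by ring
      _ ≤ K * B := mul_le_mul_of_nonneg_left hrest hK0
  · -- (2) the tortoise derivative
    obtain ⟨hr, -, hT0, -, -, hA0, hφ0⟩ := key h1
    have e : 1 * ((1 - m) * u + m * T) ^ 2 ≤ K * (cR * ((1 - m) * u + m * T) ^ 2) :=
      morawetzBulk_mul_le_mul_mul (sq_nonneg _) hρ₀0 (hcRlow hr h2) zero_le_one hK4
    have hrest : cR * ((1 - m) * u + m * T) ^ 2 ≤ B := by rw [hB]; linarith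
    rw [one_mul] at e
    exact e.trans (mul_le_mul_of_nonneg_left hrest hK0)
  · -- (3) the time derivative near the photon sphere
    obtain ⟨hr, -, hT0, hD0, -, hA0, hφ0⟩ := key (by linarith)
    have hX : 0 ≤ (r - 3 * M) ^ 2 * T ^ 2 := by positivity
    have hnum : 2 * r ^ 7 ≤ 15 ^ 7 * M ^ 6 * (r - 2 * M) := by
      have h71 : (4 * r) ^ 7 ≤ (15 * M) ^ 7 :=
        pow_le_pow_left₀ (by positivity) (by linarith only [h2]) 7
      linarith only [h71, mul_nonneg (by positivity : (0 : ℝ) ≤ 15 ^ 7 * M ^ 6)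
        (by linarith only [h1] : (0 : ℝ) ≤ 4 * (r - 2 * M) - M), pow_nonneg hr.le 7]
    have hcoef : 1 ≤ 15 ^ 7 * M ^ 6 * (r - 2 * M) / (2 * r ^ 7) := by
      rwa [one_le_div₀ (by positivity)]
    have hA' : (r - 3 * M) ^ 2 * T ^ 2 ≤ K₃ * M ^ 3 * (cT * T ^ 2) :=
      calc (r - 3 * M) ^ 2 * T ^ 2 = 1 * ((r - 3 * M) ^ 2 * T ^ 2) := (one_mul _).symm
        _ ≤ 15 ^ 7 * M ^ 6 * (r - 2 * M) / (2 * r ^ 7) * ((r - 3 * M) ^ 2 * T ^ 2) :=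
            mul_le_mul_of_nonneg_right hcoef hX
        _ = K₃ * M ^ 3 * (cT * T ^ 2) := by rw [hK₃, hcT]; ring
    have hrest : cT * T ^ 2 ≤ B := by rw [hB]; linarith
    calc (r - 3 * M) ^ 2 * T ^ 2 ≤ K₃ * M ^ 3 * (cT * T ^ 2) := hA'
      _ ≤ K * M ^ 3 * (cT * T ^ 2) :=
          mul_le_mul_of_nonneg_right (mul_le_mul_of_nonneg_right hK5 (by positivity)) hT0
      _ ≤ K * M ^ 3 * B := mul_le_mul_of_nonneg_left hrest (by positivity)
  · -- (4) the zeroth-order term in the far layer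
    obtain ⟨hr, -, hT0, hD0, -, hA0, hφ0⟩ := key (by linarith)
    have h7 : 7 * M ≤ r := by linarith
    rw [if_pos h7] at hc₀
    have hnum : r ^ 5 ≤ 2 * 9 ^ 5 * M ^ 4 * (r - 7 * M) := by
      have h51 : r ^ 5 ≤ (9 * M) ^ 5 := pow_le_pow_left₀ hr.le h2 5
      linarith only [h51, mul_nonneg (by positivity : (0 : ℝ) ≤ 9 ^ 5 * M ^ 4)
        (by linarith only [h1] : (0 : ℝ) ≤ 2 * (r - 7 * M) - M)]
    have hcoef : 1 ≤ 2 * 9 ^ 5 * M ^ 4 * (r - 7 * M) / r ^ 5 := by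
      rwa [one_le_div₀ (pow_pos hr 5)]
    have hA' : φ ^ 2 ≤ K₄ * M ^ 3 * (c₀ * φ ^ 2) :=
      calc φ ^ 2 = 1 * φ ^ 2 := (one_mul _).symm
        _ ≤ 2 * 9 ^ 5 * M ^ 4 * (r - 7 * M) / r ^ 5 * φ ^ 2 :=
            mul_le_mul_of_nonneg_right hcoef (sq_nonneg φ)
        _ = K₄ * M ^ 3 * (c₀ * φ ^ 2) := by rw [hK₄, hc₀]; ring
    have hrest : c₀ * φ ^ 2 ≤ B := by rw [hB]; linarith
    calc φ ^ 2 ≤ K₄ * M ^ 3 * (c₀ * φ ^ 2) := hA'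
      _ ≤ K * M ^ 3 * (c₀ * φ ^ 2) :=
          mul_le_mul_of_nonneg_right (mul_le_mul_of_nonneg_right hK6 (by positivity)) hφ0
      _ ≤ K * M ^ 3 * B := mul_le_mul_of_nonneg_left hrest (by positivity)

/-! ### The two structural facts at a point of `E4` -/

/-- **Cauchy–Schwarz for the radial derivative** at zero spin: `(x⃗·a)² ≤ r² ∑ᵢ aᵢ²` with
`r = Kerr.radius 0 x`, `r² = (x¹)² + (x²)² + (x³)²`. [folklore] -/
theorem morawetzBulk_radial_sq_le (x : E4) (a : Fin 3 → ℝ) :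
    (∑ i : Fin 3, x i.succ * a i) ^ 2 ≤ Kerr.radius 0 x ^ 2 * ∑ i : Fin 3, a i ^ 2 := by
  have hr : ∑ i : Fin 3, x i.succ ^ 2 = Kerr.radius 0 x ^ 2 := by
    rw [Kerr.radius_zero_left, E4.spatialNorm_sq]
    simp only [Fin.sum_univ_three, Fin.succ_zero_eq_one, Fin.succ_one_eq_two,
      Kerr.fin_succ_two_eq_three]
  rw [← hr]
  exact Finset.sum_mul_sq_le_sq_mul_sq Finset.univ (fun i : Fin 3 ↦ x i.succ) a

/-- The tails-cut profile `μ = χ(2 − r/8M) · 2H`, `H = Kerr.scalarH M 0 x = M/r`, satisfies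
`0 ≤ μ ≤ 2M/r` on all of `E4` (`0 ≤ χ ≤ 1`, `H ≥ 0` for `M ≥ 0`). [folklore] -/
theorem morawetzBulk_profile_bounds {M : ℝ} (hM : 0 < M) (x : E4) :
    0 ≤ Real.smoothTransition (2 - Kerr.radius 0 x / (8 * M)) * (2 * Kerr.scalarH M 0 x) ∧
      Real.smoothTransition (2 - Kerr.radius 0 x / (8 * M)) * (2 * Kerr.scalarH M 0 x) ≤
        2 * M / Kerr.radius 0 x := by
  have hχ0 := Real.smoothTransition.nonneg (2 - Kerr.radius 0 x / (8 * M))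
  have hχ1 := Real.smoothTransition.le_one (2 - Kerr.radius 0 x / (8 * M))
  have hH0 : 0 ≤ Kerr.scalarH M 0 x := Kerr.scalarH_nonneg hM.le 0 x
  have hH : 2 * Kerr.scalarH M 0 x = 2 * M / Kerr.radius 0 x := by
    rw [hardy_scalarH_zero, mul_div_assoc]
  refine ⟨mul_nonneg hχ0 (by positivity), ?_⟩
  rw [← hH]
  exact mul_le_of_le_one_left (by positivity) hχ1

/-! ### The registered stub -/

/-- **The designed Morawetz bulk dominates the energy density away from the photon sphere and
the horizon** (crux `AdiabaticMultiKerrILED`, line `Sketch`, stub `morawetzBulk_dominates`).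
With `r = Kerr.radius 0 x`, `μ = χ(2 − r/8M) · 2 Kerr.scalarH M 0 x`, the bulk
`𝔅 = c_T (∂₀Φ)² + c_R (∂_{r*}Φ)² + c_A |∇̸Φ|² + c_0 Φ²` of the statement and one constant
`K = K(M, η, R_z) ≥ 0`: (1) `∑_μ (∂_μΦ)² ≤ K 𝔅` on `2M + η ≤ r ≤ R_z` off `(5M/2, 7M/2)`;
(2) `(∂_{r*}Φ)² ≤ K 𝔅` on `2M < r ≤ R_z`; (3) `(r − 3M)² (∂₀Φ)² ≤ K M³ 𝔅` on `[9M/4, 15M/4]`;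
(4) `Φ² ≤ K M³ 𝔅` on `[15M/2, 9M]`. Reduced to `morawetzBulk_dominates_abstract` by
Cauchy–Schwarz (`morawetzBulk_radial_sq_le`) and `0 ≤ μ ≤ 2M/r` (`morawetzBulk_profile_bounds`).
Dafermos–Rodnianski arXiv:0811.0354, §4.1. [folklore] -/
theorem morawetzBulk_dominates : ∀ (M η Rz : ℝ), 0 < M → 0 < η → ∃ K : ℝ, 0 ≤ K ∧ ∀ (Φ : E4 → ℝ) (x : E4), DifferentiableAt ℝ Φ x → let B : ℝ := (((Kerr.radius 0 x - 2 * M) * M ^ 3 * (Kerr.radius 0 x - 3 * M) ^ 2 / (2 * Kerr.radius 0 x ^ 7)) * fderiv ℝ Φ x (E4.basisVector 0) ^ 2 + (3 * M / (20 * Kerr.radius 0 x ^ 2)) * ((1 - (Real.smoothTransition (2 - Kerr.radius 0 x / (8 * M)) * (2 * Kerr.scalarH M 0 x))) * (∑ i : Fin 3, x i.succ * fderiv ℝ Φ x (E4.basisVector i.succ)) / Kerr.radius 0 x + (Real.smoothTransition (2 - Kerr.radius 0 x / (8 * M)) * (2 * Kerr.scalarH M 0 x)) * fderiv ℝ Φ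 x (E4.basisVector 0)) ^ 2 + ((Kerr.radius 0 x - 3 * M) ^ 2 / (8 * Kerr.radius 0 x ^ 3)) * ((∑ i : Fin 3, fderiv ℝ Φ x (E4.basisVector i.succ) ^ 2) - ((∑ i : Fin 3, x i.succ * fderiv ℝ Φ x (E4.basisVector i.succ)) / Kerr.radius 0 x) ^ 2) + (if 7 * M ≤ Kerr.radius 0 x then M * (Kerr.radius 0 x - 7 * M) / (4 * Kerr.radius 0 x ^ 5) else 0) * Φ x ^ 2); (2 * M + η ≤ Kerr.radius 0 x → Kerr.radius 0 x ≤ Rz → (Kerr.radius 0 x ≤ 5 * M / 2 ∨ 7 * M / 2 ≤ Kerr.radius 0 x) → ∑ μ : Fin 4, fderiv ℝ Φ x (E4.basisVector μ) ^ 2 ≤ K * B) ∧ (2 * M < Kerr.radius 0 x → Kerr.radius 0 x ≤ Rz → ((1 - (Real.smoothTransition (2 - Kerr.radius 0 x / (8 * M)) * (2 * Kerr.scalarH M 0 x))) * (∑ i : Fin 3, x i.succ * fderiv ℝ Φ x (E4.basisVector i.succ)) / Kerr.radius 0 x + (Real.smoothTransition (2 - Kerr.radius 0 x / (8 * M)) *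 (2 * Kerr.scalarH M 0 x)) * fderiv ℝ Φ x (E4.basisVector 0)) ^ 2 ≤ K * B) ∧ (9 * M / 4 ≤ Kerr.radius 0 x → Kerr.radius 0 x ≤ 15 * M / 4 → (Kerr.radius 0 x - 3 * M) ^ 2 * fderiv ℝ Φ x (E4.basisVector 0) ^ 2 ≤ K * M ^ 3 * B) ∧ (15 * M / 2 ≤ Kerr.radius 0 x → Kerr.radius 0 x ≤ 9 * M → Φ x ^ 2 ≤ K * M ^ 3 * B) := by
  intro M η Rz hM hη
  obtain ⟨K, hK0, hK⟩ := morawetzBulk_dominates_abstract Rz hM hη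
  refine ⟨K, hK0, ?_⟩
  intro Φ x _ B
  obtain ⟨c1, c2, c3, c4⟩ := hK (Kerr.radius 0 x) (fderiv ℝ Φ x (E4.basisVector 0))
    (∑ i : Fin 3, x i.succ * fderiv ℝ Φ x (E4.basisVector i.succ))
    (∑ i : Fin 3, fderiv ℝ Φ x (E4.basisVector i.succ) ^ 2)
    (Real.smoothTransition (2 - Kerr.radius 0 x / (8 * M)) * (2 * Kerr.scalarH M 0 x)) (Φ x) B
    (morawetzBulk_radial_sq_le x fun i ↦ fderiv ℝ Φ x (E4.basisVector i.succ))
    (morawetzBulk_profile_bounds hM x).1 (morawetzBulk_profile_bounds hM x).2 rfl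
  refine ⟨fun h1 h2 h3 ↦ ?_, c2, c3, c4⟩
  rw [Fin.sum_univ_succ]
  exact c1 h1 h2 h3

end Summit.FinalStateConjecture.FinalStateConjecture.Theorems
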